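/-
Copyright (c) 2026 Gabriel Dahia. All rights reserved.
Released under Apache 2.0 license as described in the file LICENSE.
Authors: Gabriel Dahia

Ported into this library from `DensityHalesJewett/Word.lean` of
github.com/gdahia/DensityHalesJewett @ 27e0e64 (Apache-2.0): the namespace `DensityHalesJewett`
becomes `Literature.Combinatorics.HalesJewett`, module names are flattened and docstrings
carry provenance tags; the mathematics is unchanged.
-/
import Mathlib.Algebra.BigOperators.Expect
import Mathlib.Algebra.Order.BigOperators.Expect
import Mathlib.Combinatorics.HalesJewett
import Mathlib.Data.Finset.Density
import Mathlib.Data.Real.Basic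
import Mathlib.Tactic.Linarith
import Mathlib.Tactic.Ring
import HarnessLib

/-!
# Finite word spaces

Uniform density, fibers, and elementary averaging results used in the density Hales--Jewett
argument.  We use `Finset.dens` for uniform density, `Sum.elim` to concatenate words on disjoint
coordinate types, and `Equiv.sumArrowEquivProdArrow` for the underlying decomposition of a word on
a sum of coordinate types.

## Source of the formalization

This file is a port (namespace, imports and docstring tags only; proofs unchanged) of the file
`DensityHalesJewett/Word.lean`
of the Apache-2.0 Lean 4 development github.com/gdahia/DensityHalesJewett @ 27e0e64 (G. Dahia 2026),
a formalization of Dodos–Kanellopoulos–Tyros, *A simple proof of the density Hales–Jewett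
theorem* (IMRN 2014).
Paper locators in the tags refer to that article (arXiv:1209.4986 numbering: Thm 1, Prop. 2–3,
Lemma 4, Cor. 5, Prop. 6, Lemmas 7–8, Def. 9, Lemma 10, Cor. 11, Lemma 12, Cor. 13).
Status (2026-08-15): of this port the tree holds `Word`, `Subspace`, `FiniteUnions`, `Canonization`,
`GrahamRothschild` and `Insensitive` (this directory). The density Hales–Jewett theorem itself was
completed in the tree by the parallel development `DKTSubspaces` / `DKTCorrelation` /
`DensityHalesJewettProofs` (`DensityHalesJewett_holds`; it builds on `Word.lean` and `Subspace.lean`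
of this port), and Szemerédi's theorem is discharged as
`Literature.Combinatorics.Additive.SzemerediTheorem_holds` in
`NumberTheory/Sieve/ParityWave0GreenTaoHolds.lean`; the remaining upstream files (`UniformFibers`,
the tilings of `Insensitive`, `DensityIncrement/…`, `Main`) were therefore not ported.

## References
* P. Dodos, V. Kanellopoulos, K. Tyros, *A simple proof of the density Hales–Jewett theorem*,
  IMRN 2014 (12), 3340–3352, arXiv:1209.4986. [cite: DodosKanellopoulosTyros2014]
* H. Furstenberg, Y. Katznelson, *A density version of the Hales–Jewett theorem*, J. Anal. Math. 57
  (1991), 64–119 — the theorem. [cite: FurstenbergKatznelson1991]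
* D. H. J. Polymath, *A new proof of the density Hales–Jewett theorem*, Ann. of Math. 175 (2012),
  1283–1327. [cite: Polymath2012DHJ]
-/

open Finset
open scoped BigOperators

namespace Literature.Combinatorics.HalesJewett

/-- The fiber of a word family above a fixed prefix.  Words on a sum of coordinate types are
concatenations `Sum.elim x y` of their two parts. [folklore] -/
def fiber {α ι κ : Type*} [Fintype (κ → α)] [DecidableEq (ι ⊕ κ → α)]
    (A : Finset (ι ⊕ κ → α)) (x : ι → α) : Finset (κ → α) :=
  Finset.univ.filter fun y ↦ Sum.elim x y ∈ A

/-- Membership in a fiber: `y ∈ fiber A x ↔ Sum.elim x y ∈ A`. [folklore] -/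
@[simp]
lemma mem_fiber {α ι κ : Type*} [Fintype (κ → α)] [DecidableEq (ι ⊕ κ → α)]
    {A : Finset (ι ⊕ κ → α)} {x : ι → α} {y : κ → α} :
    y ∈ fiber A x ↔ Sum.elim x y ∈ A := by
  simp [fiber]

/-- Uniform density is the average of the uniform densities of the fibers. [folklore] -/
lemma average_density_fiber {α ι κ : Type*} [Fintype (ι → α)] [Fintype (κ → α)]
    [Fintype (ι ⊕ κ → α)] [DecidableEq (ι ⊕ κ → α)]
    (A : Finset (ι ⊕ κ → α)) :
    (𝔼 x : ι → α, ((fiber A x).dens : ℝ)) = (A.dens : ℝ) := by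
  classical
  simp_rw [← Finset.expect_indicator_one]
  rw [← Finset.expect_product']
  apply Finset.expect_equiv (Equiv.sumArrowEquivProdArrow ι κ α).symm
  · simp
  · rintro ⟨x, y⟩ -
    simp [Set.indicator_apply, Equiv.sumArrowEquivProdArrow]

/-- A bounded function with large average exceeds a lower threshold on a quantitatively large
set. [folklore] -/
lemma density_ge_threshold {X : Type*} [Fintype X] [Nonempty X]
    (f : X → ℝ) (a b : ℝ) (hf₁ : ∀ x, f x ≤ 1)
    (hba : b < a) (havg : a ≤ 𝔼 x : X, f x) :
    (a - b) / (1 - b) ≤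
      ((Finset.univ.filter fun x ↦ b ≤ f x).dens : ℝ) := by
  classical
  let H := Finset.univ.filter fun x ↦ b ≤ f x
  change (a - b) / (1 - b) ≤ (H.dens : ℝ)
  have h1b : 0 < 1 - b := by
    rw [sub_pos]
    exact hba.trans_le <| havg.trans <|
      Finset.expect_le Finset.univ_nonempty fun x _ ↦ hf₁ x
  rw [div_le_iff₀ h1b, sub_le_iff_le_add]
  apply havg.trans
  convert Finset.expect_le_expect (s := Finset.univ) (f := f)
    (g := fun x ↦ b + (1 - b) * Set.indicator (H : Set X) 1 x) ?_ using 1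
  · symm
    rw [Finset.expect_add_distrib]
    simp only [Fintype.expect_const, ← Finset.mul_expect, Finset.expect_indicator_one]
    ring
  · intro x _
    by_cases hx : b ≤ f x <;> simp [H, hx] <;> linarith [hf₁ x]

end Literature.Combinatorics.HalesJewett
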